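import Summits.CriticalPhenomena.CardyFormulaZ2.Theorems.CardySelfRefinementDefs
import Summits.CriticalPhenomena.CardyFormulaZ2.Theorems.CardySelfRefinementTrivialSectorRateStubFarFieldFactorisation
import Literature.Probability.Percolation.QuadCrossingFourArmShadow
import Literature.Probability.Percolation.OpenPathAnnulusCrossing
import HarnessLib

/-!
# Stub `exists_openWalk_of_mem_Rel` of line `far-field-is-a-quarter-turn` (crux `TrivialSectorRate`,
stmt-CriticalPhenomena-10266): A RELEVANT BOUNDARY BLOCK SENDS AN OPEN WALK FAR AWAY

Input `2/2` of the corner bound of the open stub `stub_boundaryRelevance` (the other input is the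
primal one-arm decay `openArm_decay_along`, file `…StubBoundaryRelevanceOpenArm.lean`): the
DETERMINISTIC fact that a configuration `ω` for which the lattice `D`-box
`B = boxEdgesAt (ctr k u) D` about the block centre `k•u` is pivotal AS A SET for the localised joint
crossing event `Aloc m F η` (`ω ∈ Rel k m F η u D`) contains an OPEN lattice walk from a site of the
vertex box `k•u + [-D, D]²` to a site outside `k•u + [-N, N]²`, as soon as the two distinguished sides
of every quad of the family are `L`-apart with `8 (N + D + 2) η ≤ L`.

Proof (`exists_openWalk_of_mem_Rel`).  `Aloc` is an upper set (`isUpperSet_Aloc`), so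
`ω ∪ B ∈ Aloc ∌ ω \ B` (`union_mem_and_sdiff_notMem_of_isPivotalOn`); hence some quad `F i` is crossed
(closure semantics on lattice configurations = a crossing inside the drawn open edges,
`mem_configOf_iff_exists_isCrossing`, mesh `δ = η√2`) by the window part `E⁺ = (ω ∪ B) ∩ W` and not
by `E⁻ = (ω \ B) ∩ W`.  Take such a crossing `K ⊆ openEdgeUnion δ E⁺`: it is compact, connected,
meets `∂₀(F i)` and `∂₂(F i)` (at distance `≥ L`), so one of its points `f` is at distance `≥ L/2`
from the drawn centre `c = δ (k•u)`, and one of its points lies on NO drawn edge of `E⁻`, i.e. on a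
drawn edge `{x, y} ∈ B` of `E⁺` (so `x - k•u ∈ [-D, D]²`).  The drawn edge of `E⁺` through `f` has an
end `x'` within `δ` of `f`, hence outside `k•u + [-N, N]²` (`L/2 - δ > 2ηN = √2 N δ`).  The open
edges of `E⁺` drawn through the connected `K` are chained by `E⁺`-open lattice walks
(`openConnIn_of_isPreconnected_subset_openEdgeUnion`, `OpenPathAnnulusCrossing.lean`: two drawn
nearest-neighbour segments meet only at a common lattice end), giving a lattice walk from `x'` to
`x` with edges in `E⁺ ⊆ ω ∪ B`; cut it at its first vertex of the box `k•u + [-D, D]²`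
(`exists_walk_to_first_mem`): the edges before that vertex have an end off the box, so are not in
`B`, so are in `ω`.  Reversing gives the walk.  (`m = 0` is vacuous: `Aloc = univ` has no pivotal
set; `L ≤ 0` contradicts `8 (N + D + 2) η ≤ L`.)

Target file:
`Summits/CriticalPhenomena/CardyFormulaZ2/Theorems/CardySelfRefinementTrivialSectorRateStubBoundaryRelevancePivotalWalk.lean`.
-/

noncomputable section

namespace Summit.CriticalPhenomena.CardyFormulaZ2.Theorems.CardySelfRefinement.FarField

open Set MeasureTheory
open Literature.Probability.LatticeModels Literature.Probability.Percolation
open Literature.Probability.Percolation.QuadCrossing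
open Summit.CriticalPhenomena.CardyFormulaZ2.Theses.CardySelfRefinement

/-! ### Cutting a walk at its first vertex of a target set -/

/-- **First entrance.**  A lattice walk whose edges lie in `ω ∪ B`, where every edge of `B` has both
ends in `T`, and which ends in `T`, has an initial piece ending at a vertex of `T` all of whose
edges lie in `ω`: cut at the first vertex of `T`; every earlier edge has its first end off `T`, so
is not in `B`. -/
theorem exists_walk_to_first_mem {ω B : Set (Sym2 (Site 2))} {T : Set (Site 2)}
    (hB : ∀ e ∈ B, ∀ x ∈ e, x ∈ T) {x y : Site 2} (W : (zdGraph 2).Walk x y)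
    (hW : ∀ e ∈ W.edges, e ∈ ω ∪ B) (hy : y ∈ T) :
    ∃ (z : Site 2) (W' : (zdGraph 2).Walk x z), z ∈ T ∧ ∀ e ∈ W'.edges, e ∈ ω := by
  induction W with
  | nil => exact ⟨_, SimpleGraph.Walk.nil, hy, fun e he => by simp at he⟩
  | @cons a b _ h W ih =>
    by_cases ha : a ∈ T
    · exact ⟨a, SimpleGraph.Walk.nil, ha, fun e he => by simp at he⟩
    · have hW₁ : ∀ e ∈ W.edges, e ∈ ω ∪ B := fun e he =>
        hW e (by rw [SimpleGraph.Walk.edges_cons]; exact List.mem_cons_of_mem _ he)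
      obtain ⟨z, W', hz, hW'⟩ := ih hW₁ hy
      refine ⟨z, SimpleGraph.Walk.cons h W', hz, fun e he => ?_⟩
      rw [SimpleGraph.Walk.edges_cons, List.mem_cons] at he
      rcases he with rfl | he
      · have hab : s(a, b) ∈ ω ∪ B :=
          hW _ (by rw [SimpleGraph.Walk.edges_cons]; exact List.mem_cons.2 (Or.inl rfl))
        exact hab.elim id fun habB => absurd (hB _ habB a (Sym2.mem_mk_left a b)) ha
      · exact hW' e he

/-! ### The stub -/

/-- **A relevant block sends an open walk far away** (registered stub `exists_openWalk_of_mem_Rel`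
of crux stmt-CriticalPhenomena-10266, line `far-field-is-a-quarter-turn`).  If the two
distinguished sides of every quad `F i` are `L`-apart, `8 (N + D + 2) η ≤ L`, and the lattice `D`-box
about the block centre `k•u` is pivotal as a set for `Aloc m F η` in `ω`, then `ω` contains an open
lattice walk from a site of `k•u + [-D, D]²` to a site outside `k•u + [-N, N]²`. -/
theorem exists_openWalk_of_mem_Rel (k m : ℕ) (F : Fin m → Quad (univ : Set ℂ)) {η : ℝ} (hη : 0 < η)
    {L : ℝ} (hL : ∀ i, ∀ a ∈ (F i).side 0, ∀ b ∈ (F i).side 2, L ≤ dist a b)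
    (u : Site 2) {D N : ℕ} (hN : 8 * ((N : ℝ) + D + 2) * η ≤ L) {ω : BondConfig (Site 2)}
    (hω : ω ∈ Rel k m F η u D) :
    ∃ (v w : Site 2) (p : (zdGraph 2).Walk v w),
      v - ctr k u ∈ box 2 D ∧ w - ctr k u ∉ box 2 N ∧ ∀ e ∈ p.edges, e ∈ ω := by
  classical
  have hz : ∀ x : Site 2, (η : ℂ) * squareLatticeEmbedding.z x = meshPoint (η * Real.sqrt 2) x :=
    eta_mul_z_eq_meshPoint η
  have hs0 : (0 : ℝ) < Real.sqrt 2 := Real.sqrt_pos.2 (by norm_num)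
  have hss : Real.sqrt 2 * Real.sqrt 2 = 2 := Real.mul_self_sqrt (by norm_num)
  have hs2 : Real.sqrt 2 < 2 := by nlinarith
  set δ : ℝ := η * Real.sqrt 2 with hδdef
  have hδ : 0 < δ := mul_pos hη hs0
  set v : Site 2 := ctr k u with hvdef
  set c : ℂ := meshPoint δ v with hcdef
  set B : Set (Sym2 (Site 2)) := boxEdgesAt v D with hBdef
  have hRel : IsPivotalOn (Aloc m F η) B ω := hω
  -- Step 1: normal form of relevance for the upper set `Aloc`
  obtain ⟨hU, hDn⟩ := union_mem_and_sdiff_notMem_of_isPivotalOn (isUpperSet_Aloc m F η) hRel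
  simp only [Aloc, Set.mem_setOf_eq] at hU hDn
  push Not at hDn
  obtain ⟨i, hi⟩ := hDn
  have hiU := hU i
  -- Step 2: a crossing inside the drawn edges of `E⁺ = (ω ∪ B) ∩ W`, none inside those of `E⁻`
  have hWE : window m F η ⊆ (zdGraph 2).edgeSet :=
    Set.iUnion_subset fun _ => Set.inter_subset_right
  have hτe : (ω ∪ B) ∩ window m F η ⊆ (zdGraph 2).edgeSet := Set.inter_subset_right.trans hWE
  have hσe : (ω \ B) ∩ window m F η ⊆ (zdGraph 2).edgeSet := Set.inter_subset_right.trans hWE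
  obtain ⟨K, hK, hKτ⟩ := (mem_configOf_iff_exists_isCrossing hη hτe (F i)).1 hiU
  have hKσ : ¬ K ⊆ openEdgeUnion δ ((ω \ B) ∩ window m F η) := fun hsub =>
    hi ((mem_configOf_iff_exists_isCrossing hη hσe (F i)).2 ⟨K, hK, hsub⟩)
  obtain ⟨hKc, hKconn, -, ⟨a, haK, ha0⟩, ⟨b, hbK, hb2⟩⟩ := hK
  -- Step 3: a point of `K` off the drawing of `E⁻` lies on a drawn edge of `B`
  obtain ⟨z₀, hz₀K, hz₀σ⟩ := Set.not_subset.1 hKσ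
  obtain ⟨x, y, hxy, ⟨hxyωB, hxyW⟩, hz₀seg⟩ := mem_openEdgeUnion_iff.1 (hKτ hz₀K)
  have hxyB : s(x, y) ∈ B := by
    by_contra hxyB
    exact hz₀σ (mem_openEdgeUnion_iff.2
      ⟨x, y, hxy, ⟨⟨hxyωB.resolve_right hxyB, hxyB⟩, hxyW⟩, hz₀seg⟩)
  have hxD : x - v ∈ box 2 D := hxyB.2 x (Sym2.mem_mk_left x y)
  have hp : (x, y) ∈ edgePairs δ ((ω ∪ B) ∩ window m F η) K :=
    ⟨hxy, ⟨hxyωB, hxyW⟩, z₀, hz₀seg, hz₀K⟩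
  -- Step 4: a point of `K` far from the centre, and the drawn edge of `E⁺` through it
  obtain ⟨f, hfK, hfar⟩ : ∃ f ∈ K, L / 2 ≤ dist f c := by
    by_cases hac : L / 2 ≤ dist a c
    · exact ⟨a, haK, hac⟩
    · refine ⟨b, hbK, ?_⟩
      have h1 := hL i a ha0 b hb2
      have h2 := dist_triangle a c b
      rw [dist_comm c b] at h2
      push Not at hac
      linarith
  obtain ⟨p', hp', hfp'⟩ := exists_mem_edgePairs_of_mem hKτ hfK
  have hfd : dist (meshPoint δ p'.1) f ≤ δ := dist_meshPoint_le_of_mem_segment hδ hp'.1 hfp'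
  have hp'N : p'.1 - v ∉ box 2 N := by
    intro hbN
    have h1 : dist (meshPoint δ p'.1) c ≤ Real.sqrt 2 * (N * δ) :=
      dist_meshPoint_le_of_sub_mem_box hδ.le hbN
    have h2 := dist_triangle f (meshPoint δ p'.1) c
    rw [dist_comm f (meshPoint δ p'.1)] at h2
    have h3 : Real.sqrt 2 * (N * δ) = 2 * N * η := by
      rw [hδdef]; linear_combination (N * η) * hss
    have h4 : δ < 2 * η := by rw [hδdef]; nlinarith
    have hD0 : (0 : ℝ) ≤ D * η := mul_nonneg (Nat.cast_nonneg D) hη.le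
    have hN0 : (0 : ℝ) ≤ N * η := mul_nonneg (Nat.cast_nonneg N) hη.le
    linarith
  -- Step 5: the drawn edges of `E⁺` through the connected `K` are chained by `E⁺`-open walks
  have hconn : (ω ∪ B) ∩ window m F η ∈ openConnIn (Set.univ : Set (Site 2)) p'.1 (x, y).1 :=
    openConnIn_of_isPreconnected_subset_openEdgeUnion hδ hKc hKconn.isPreconnected hKτ
      (S := Set.univ) (fun _ _ => Set.mem_univ _) hp' hp
  obtain ⟨W, -, hWe⟩ := exists_walk_of_mem_openConnIn hτe hconn
  -- Step 6: cut at the first vertex of the box; the earlier edges are off `B`, hence in `ω`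
  obtain ⟨z, W', hzT, hW'⟩ := exists_walk_to_first_mem (ω := ω) (B := B)
    (T := {x : Site 2 | x - v ∈ box 2 D}) (fun e he x hx => he.2 x hx) W
    (fun e he => (hWe e he).1) hxD
  refine ⟨z, p'.1, W'.reverse, hzT, hp'N, fun e he => ?_⟩
  rw [SimpleGraph.Walk.edges_reverse, List.mem_reverse] at he
  exact hW' e he

end Summit.CriticalPhenomena.CardyFormulaZ2.Theorems.CardySelfRefinement.FarField

end
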